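import Summits.BirchSwinnertonDyer.Rank1Residual.X11b.KolyvaginReciprocityOfPoitouTate
import Summits.BirchSwinnertonDyer.Rank1Residual.X11b.KummerRelaxedStructures
import Literature.NumberTheory.EllipticCurves.CasselsTateLocalCupSymmetry
import Literature.NumberTheory.EllipticCurves.CasselsTateFirstCase
import HarnessLib

/-!
# The Cassels–Tate local term at a Kolyvagin prime: vanishing gives a twisted reciprocity value
# (cell `b2b-bsdres`, team x11b3, seat p2 GEN 40, (P2-ORDER-UB) F4l)

HONEST FRAMING (cell `b2b-bsdres`, run/shared/lean/b2b/bsd-rank1-residual/, verbatim in every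
file): the goal of the cell is to DELETE the COMBINATION-SHAPED residual classes of the
Birch–Swinnerton-Dyer formula for ALL analytic-rank `≤ 1` elliptic curves over `ℚ` — "full BSD
formula for every rank `≤ 1` curve in class `C`" assembled STRICTLY from published theorems — so
that the rank-`≤ 1` remainder becomes exactly the CONSTRUCTION-SHAPED classes, which are TYPED
(missing-input `Prop`s), NOT attempted. This is not "finishing BSD". Plumbing on the PUBLISHED
Kolyvagin ORDER bound (McCallum 1991 §1 Theorem / Cor. 5.6): the local step of the one remaining
line-specific input `hloc` of `KolyvaginDescent.card_quotient_selmer_le_of_localTerm`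
(McCallum Lemma 5.3 applied to the Cassels–Tate local term at `λ`). ONE THEOREM + one helper (no
definition, no named fact, no `sorry`); nothing booked; no mark / label / count / tier moved.

* `apply_eq_zero_of_mem_kummerLocalConditionAt` — at a good finite `v ∤ p` whose local Galois
  group acts trivially on `E[p^k]` through its inertia, a cocycle of a class in the local Kummer
  condition `𝓛_v` vanishes on `I_{K_v}` (`𝓛_v = H¹_ur`, x11b3's
  `KummerPT.kummerSelmerStructure_inr_eq_unramifiedSubgroup`, + `LocBridge`).
* `exists_twisted_value_of_localTerm_eq_zero` — for Milne's first-case data `D` at level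
  `m = p^{M₀}` (auxiliary level `m²`) and a class `t = ι_* D.b'`, at a Kolyvagin prime `ℓ` (place
  `λ`, good reduction): **if the local term `inv_λ((loc_λ D.b₁ - β_λ) ∪ β'_λ)` vanishes** (and
  `inv_λ` is injective, `e` is a non-degenerate alternating Weil pairing on `E[m²]`), then for every
  `𝔔 ∣ λ`, Frobenius `F` at `𝔔` fixing `E[m²]` and `σ ∈ I_𝔔` there is `P'` with `m P' = [t, F]` and
  `e(P', [D.b₁, σ]) = 1`. Proof: `β_λ ∪ β'_λ`-free form by bilinearity is not needed — the symmetry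
  of the local Weil cup product where `E[m²]` is rational (`weilLocalCup_comm_of_forall_smul_eq`)
  puts the unramified class `β'_λ` first, x11b3's `TameCup.weilPairing_apply_eq_one_of_cupProduct_eq_zero`
  (Gross (7.6), qualitative) gives `e(φ_{β'}(g), (φ_{b₁} - φ_β)(τ)) = 1` on `Γ_{K_λ} × I_{K_λ}`,
  `φ_β` vanishes on inertia (helper), `[m]_* β' = loc b'` and `ι ∘ [m] = m` give
  `m φ_{β'}(g_F) = [t, F₀]`, and the `Γ_K`-transport `g • 𝔔 = 𝔓₀` of x11b3's
  `KolyvaginReciprocityOfPoitouTate` finishes.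

References (locators only): [cite: MilneADT2006, Ch. I §6, proof of Prop. 6.9 (first case)]
[cite: McCallumLMS1991, §5 Lemma 5.3, Thm. 5.4] [cite: GrossLMS1991, §7 (7.1)–(7.6), Prop. 8.2, §9].
-/

noncomputable section

open scoped Classical Pointwise

namespace Summit.BirchSwinnertonDyer.Rank1Residual.X11b.KolyvaginCT
open WeierstrassCurve NumberField IsDedekindDomain Field Function ValuativeRel
open Literature.NumberTheory.EllipticCurves
open Literature.NumberTheory.GaloisRepresentations
open Literature.NumberTheory.GaloisRepresentations.IsNonarchimedeanLocalField
open Literature.NumberTheory.GaloisCohomology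
open Literature.NumberTheory.GaloisRepresentations.DiscreteGaloisModule (mu MuCarrier unramifiedSubgroup)

variable (N : ℕ) (W : WeierstrassCurve ℚ) (K : Type) [Field K] [NumberField K]

/-- **A local Kummer class at a good `v ∤ p` vanishes on the local inertia group** (as a cocycle,
when the inertia group acts trivially on `E[n]`, `n = p^k`): `𝓛_v = H¹_ur(K_v, E[n])`
(`KummerPT.kummerSelmerStructure_inr_eq_unramifiedSubgroup`, Silverman X.4.4 / Milne I 3.8) and a
class with trivial inertia action is unramified iff its cocycles vanish on `I_{K_v}`
(`LocBridge.mem_unramifiedSubgroup_one_iff_forall_eq_zero`).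
[cite: SilvermanAEC2009, Cor. X.4.4] [cite: MilneADT2006, Ch. I Prop. 3.8] -/
theorem apply_eq_zero_of_mem_kummerLocalConditionAt [W.IsElliptic] {p : ℕ} [Fact p.Prime]
    {k n : ℕ} (hn : n = p ^ k) {v : HeightOneSpectrum (𝓞 K)} (hpv : ((p : ℕ) : 𝓞 K) ∉ v.asIdeal)
    (hv : (W.baseChange K).HasGoodReductionAt v)
    (hI : ∀ τ ∈ absInertia (v.adicCompletion K), ∀ P : geomTorsion (W.baseChange K) (n : ℤ),
      absGaloisRestrict K (v.adicCompletion K) τ • P = P)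
    (φ : contOneCocycles (DiscreteGaloisModule.toTopRep (GaloisRep.restrictField (v.adicCompletion K)
      ((W.baseChange K).torsionGaloisModule (n : ℤ)))))
    (hφ : oneCocycleClass _ φ ∈ (W.baseChange K).kummerLocalConditionAt (n : ℤ) (v.adicCompletion K)) :
    ∀ τ ∈ absInertia (v.adicCompletion K), φ.1 τ = 0 := by
  subst hn
  haveI : ((W.baseChange K)).IsElliptic := inferInstance
  have heq := KummerPT.kummerSelmerStructure_inr_eq_unramifiedSubgroup (W.baseChange K) p k hpv hv
  rw [WeierstrassCurve.kummerSelmerStructure_apply] at heq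
  have hmem : oneCocycleClass _ φ ∈ unramifiedSubgroup (GaloisRep.restrictField (v.adicCompletion K)
      ((W.baseChange K).torsionGaloisModule ((p ^ k : ℕ) : ℤ))) 1 := by
    have h' : oneCocycleClass _ φ ∈
        (W.baseChange K).kummerLocalConditionAt ((p ^ k : ℕ) : ℤ) (Place.Completion (Sum.inr v)) := hφ
    rw [heq] at h'
    exact h'
  exact (LocBridge.mem_unramifiedSubgroup_one_iff_forall_eq_zero _ (fun τ hτ P => hI τ hτ P) φ).mp hmem

/-- **Vanishing of the Cassels–Tate local term at a Kolyvagin prime gives a twisted reciprocity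
value** (see the module docstring): for Milne's first-case data `D` at level `m = p^{M₀}`, a class
`t = ι_* D.b'`, a Kolyvagin prime `ℓ` of good reduction, an alternating non-degenerate Weil pairing
`e` on `E[m²]` and a family of local invariant maps injective at `λ`: if
`inv_λ((loc_λ D.b₁ - β_λ) ∪ β'_λ) = 0` then for all `𝔔 ∣ λ`, Frobenii `F` at `𝔔` fixing `E[m²]` and
`σ ∈ I_𝔔`, some `P'` has `m P' = [t, F]` and `e(P', [D.b₁, σ]) = 1`.
[cite: MilneADT2006, Ch. I §6, proof of Prop. 6.9] [cite: GrossLMS1991, §7 (7.6), §9]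
[cite: McCallumLMS1991, §5 Lemma 5.3] -/
theorem exists_twisted_value_of_localTerm_eq_zero [W.IsElliptic]
    {p : ℕ} (hp : p.Prime) {M₀ : ℕ} (hM₀ : 1 ≤ M₀) {m : ℕ} (hm : m = p ^ M₀) [NeZero m]
    {ℓ : ℕ} (hℓ : IsKolyvaginPrime N W K p ℓ)
    (hgood : (W.baseChange K).HasGoodReductionAt hℓ.place)
    (e : geomTorsion (W.baseChange K) ((m * m : ℕ) : ℤ) →
      geomTorsion (W.baseChange K) ((m * m : ℕ) : ℤ) → AlgebraicClosure K)
    (hμ : ∀ S T, e S T ^ (m * m) = 1)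
    (hadd₁ : ∀ S₁ S₂ T, e (S₁ + S₂) T = e S₁ T * e S₂ T)
    (hadd₂ : ∀ S T₁ T₂, e S (T₁ + T₂) = e S T₁ * e S T₂)
    (hgal : ∀ (σ : absoluteGaloisGroup K) (S T : geomTorsion (W.baseChange K) ((m * m : ℕ) : ℤ)),
      σ • e S T = e (σ • S) (σ • T))
    (halt : ∀ T, e T T = 1) (hnondeg : ∀ T, (∀ S, e S T = 1) → T = 0)
    (inv : LocalInvariants K (m * m)) (hinv : Injective (inv (Sum.inr hℓ.place)))
    (D : FirstCaseData (W.baseChange K) m) {t : galH1Torsion (W.baseChange K) ((m * m : ℕ) : ℤ)}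
    (ht : galoisCohomology.map (inclKD (W.baseChange K) m m) 1 D.b' = t)
    (hD0 : D.localTerm e hμ hadd₁ hadd₂ hgal inv (Sum.inr hℓ.place) = 0) :
    ∀ 𝔔 ∈ hℓ.place.primesAbove, ∀ F : absoluteGaloisGroup K, IsArithFrobAt (𝓞 K) F 𝔔 →
      F ∈ torsionFixing (W.baseChange K) ((m * m : ℕ) : ℤ) →
      ∀ σ ∈ 𝔔.inertia (absoluteGaloisGroup K),
      ∃ P' : geomTorsion (W.baseChange K) ((m * m : ℕ) : ℤ),
        m • P' = h1Eval (W.baseChange K) ((m * m : ℕ) : ℤ) t F ∧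
        e P' (h1Eval (W.baseChange K) ((m * m : ℕ) : ℤ) D.b₁ σ) = 1 := by
  intro 𝔔 h𝔔 F hF hFfix σ hσ
  subst hm
  -- compactness of absolute Galois groups (cup products), as a local hypothesis
  have _hΓc : ∀ (L : Type) [Field L], CompactSpace (absoluteGaloisGroup L) :=
    fun L _ => absoluteGaloisGroup_compactSpace L
  haveI : Fact p.Prime := ⟨hp⟩
  set lam := hℓ.place
  haveI : NeZero (p ^ M₀ * p ^ M₀) := ⟨mul_ne_zero (NeZero.ne _) (NeZero.ne _)⟩
  have hn2 : p ^ M₀ * p ^ M₀ = p ^ (2 * M₀) := by rw [two_mul, pow_add]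
  have hp0 : ((p ^ M₀ * p ^ M₀ : ℕ) : ℤ) ≠ 0 := by exact_mod_cast NeZero.ne (p ^ M₀ * p ^ M₀)
  haveI : CharZero (lam.adicCompletion K) :=
    charZero_of_injective_algebraMap (algebraMap K (lam.adicCompletion K)).injective
  -- `p ∉ λ`, `m² ∉ λ`
  have hpv : ((p : ℕ) : 𝓞 K) ∉ lam.asIdeal :=
    not_natCast_mem_of_prime_ne hℓ.prime hp hℓ.2.2.2.1 lam hℓ.mem_place
  have hqv : ((((p ^ M₀ * p ^ M₀ : ℕ) : ℤ)) : 𝓞 K) ∉ lam.asIdeal := by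
    rw [Int.cast_natCast, hn2, Nat.cast_pow]
    exact fun h => hpv (lam.isPrime.mem_of_pow_mem _ h)
  -- the prime `𝔓₀ ∣ λ` cut out by `K̄ → \bar K_λ`; `g • 𝔔 = 𝔓₀`
  have h𝔓₀ : adicCompletionPrime K lam ∈ lam.primesAbove := adicCompletionPrime_mem_primesAbove K lam
  obtain ⟨g, hg⟩ := HeightOneSpectrum.exists_smul_eq_of_mem_primesAbove_holds h𝔔 h𝔓₀
  have hDeq := decompositionSubgroup_adicCompletionPrime_eq_range K lam
  have hIeq := inertia_adicCompletionPrime_eq_map_absInertia K lam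
  have hF₀ : IsArithFrobAt (𝓞 K) (g * F * g⁻¹) (adicCompletionPrime K lam) := by
    have h := hF.conj g
    rwa [hg] at h
  have hF₀fix : g * F * g⁻¹ ∈ torsionFixing (W.baseChange K) ((p ^ M₀ * p ^ M₀ : ℕ) : ℤ) :=
    (torsionFixing_normal (W.baseChange K) _).conj_mem F hFfix g
  have hσ₀ : g * σ * g⁻¹ ∈ (adicCompletionPrime K lam).inertia (absoluteGaloisGroup K) := by
    rw [← hg]
    intro x
    have hx := Ideal.smul_mem_pointwise_smul g _ 𝔔 (hσ (g⁻¹ • x))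
    rwa [smul_sub, smul_inv_smul, ← mul_smul, ← mul_smul] at hx
  -- inertia at `𝔓₀` fixes `E[m²]` (good reduction, `λ ∤ p`)
  have hI₀ : (adicCompletionPrime K lam).inertia (absoluteGaloisGroup K) ≤
      torsionFixing (W.baseChange K) ((p ^ M₀ * p ^ M₀ : ℕ) : ℤ) := fun τ hτ =>
    (mem_torsionFixing_iff _ _).mpr fun Q =>
      (W.baseChange K).smul_geomTorsion_eq_of_mem_inertia hgood hqv h𝔓₀ hτ Q
  have hσ₀fix : g * σ * g⁻¹ ∈ torsionFixing (W.baseChange K) ((p ^ M₀ * p ^ M₀ : ℕ) : ℤ) := hI₀ hσ₀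
  -- `F₀ = res gF`, `σ₀ = res t'` with `t' ∈ I_{K_λ}`
  obtain ⟨gF, hgF⟩ : ∃ gF : absoluteGaloisGroup (lam.adicCompletion K),
      absGaloisRestrict K (lam.adicCompletion K) gF = g * F * g⁻¹ := by
    have hmem : g * F * g⁻¹ ∈
        (adicCompletionPrime K lam).decompositionSubgroup (absoluteGaloisGroup K) :=
      hF₀.mem_stabilizer
    rw [hDeq] at hmem
    obtain ⟨gF, hgF⟩ := hmem
    exact ⟨gF, hgF⟩
  obtain ⟨t', ht', hgt⟩ : ∃ t' ∈ absInertia (lam.adicCompletion K),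
      absGaloisRestrict K (lam.adicCompletion K) t' = g * σ * g⁻¹ := by
    have hmem := hσ₀
    rw [hIeq] at hmem
    obtain ⟨t', ht', hgt⟩ := hmem
    exact ⟨t', ht', hgt⟩
  -- `Γ_{K_λ}` acts trivially on `E[m²]`
  have htriv : ∀ (g' : absoluteGaloisGroup (lam.adicCompletion K))
      (Q : geomTorsion (W.baseChange K) ((p ^ M₀ * p ^ M₀ : ℕ) : ℤ)),
      absGaloisRestrict K (lam.adicCompletion K) g' • Q = Q := by
    intro g' Q
    have hd : absGaloisRestrict K (lam.adicCompletion K) g' ∈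
        (adicCompletionPrime K lam).decompositionSubgroup (absoluteGaloisGroup K) := by
      rw [hDeq]; exact ⟨g', rfl⟩
    obtain ⟨k, i, u, hi, hu, hdeq⟩ := exists_eq_frobenius_pow_mul_of_mem_decompositionSubgroup
      h𝔓₀ hF₀ (isOpen_torsionFixing (W.baseChange K) hp0) hd
    have hmem : absGaloisRestrict K (lam.adicCompletion K) g' ∈
        torsionFixing (W.baseChange K) ((p ^ M₀ * p ^ M₀ : ℕ) : ℤ) := by
      rw [hdeq]
      exact Subgroup.mul_mem _ (Subgroup.mul_mem _ (Subgroup.pow_mem _ hF₀fix k) (hI₀ hi)) hu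
    exact smul_eq_of_mem_torsionFixing _ _ hmem Q
  -- and on `E[m]` (a subgroup of `E[m²]`)
  have htrivm : ∀ (g' : absoluteGaloisGroup (lam.adicCompletion K))
      (Q : geomTorsion (W.baseChange K) ((p ^ M₀ : ℕ) : ℤ)),
      absGaloisRestrict K (lam.adicCompletion K) g' • Q = Q := by
    intro g' Q
    have h := congrArg (fun S : geomTorsion (W.baseChange K) ((p ^ M₀ * p ^ M₀ : ℕ) : ℤ) =>
      (S : geomPoints (W.baseChange K))) (htriv g' (inclKD (W.baseChange K) (p ^ M₀) (p ^ M₀) Q))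
    exact Subtype.ext h
  -- the residue characteristic of `K_λ` is prime to `m²`
  have hnc : ¬ ringChar 𝓀[lam.adicCompletion K] ∣ p ^ M₀ * p ^ M₀ := fun h =>
    GaloisImage.ringChar_residueField_adicCompletion_ne_of_not_mem lam p hpv
      ((Nat.prime_dvd_prime_iff_eq (ringChar_residueField_prime (F := lam.adicCompletion K)) hp).mp
        ((ringChar_residueField_prime (F := lam.adicCompletion K)).dvd_of_dvd_pow (hn2 ▸ h))).symm
  -- a frame `E[m²] ≃ (ℤ/m²)²`
  obtain ⟨ε₀⟩ := nonempty_addEquiv_geomTorsion (W.baseChange K) p (2 * M₀) (by omega)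
    (Nat.cast_ne_zero.mpr hp.ne_zero)
  have hε : Nonempty (geomTorsion (W.baseChange K) ((p ^ M₀ * p ^ M₀ : ℕ) : ℤ) ≃+
      ZMod (p ^ M₀ * p ^ M₀) × ZMod (p ^ M₀ * p ^ M₀)) := by
    rw [hn2]
    exact ⟨ε₀.trans (LinearEquiv.finTwoArrow ℤ (ZMod (p ^ (2 * M₀)))).toAddEquiv⟩
  obtain ⟨ε⟩ := hε
  -- ### the local classes as cocycles on `Γ_{K_λ}`
  let ρF : DiscreteGaloisModule (lam.adicCompletion K) (geomTorsion (W.baseChange K) ((p ^ M₀ * p ^ M₀ : ℕ) : ℤ)) :=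
    GaloisRep.restrictField (lam.adicCompletion K) ((W.baseChange K).torsionGaloisModule ((p ^ M₀ * p ^ M₀ : ℕ) : ℤ))
  have htrivX : ∀ (g' : absoluteGaloisGroup (lam.adicCompletion K)) (x : ρF.toTopRep),
      ρF.toTopRep.ρ g' x = x := htriv
  let rep : galoisCohomology ρF 1 → contOneCocycles ρF.toTopRep :=
    surjInv (oneCocycleClass_surjective ρF.toTopRep)
  have hrep : ∀ a : galoisCohomology ρF 1, oneCocycleClass ρF.toTopRep (rep a) = a :=
    fun a => surjInv_eq (oneCocycleClass_surjective ρF.toTopRep) a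
  -- the local lifts at `λ`, re-typed over `K_λ = Place.Completion (Sum.inr λ)`
  let β₀ : galoisCohomology ρF 1 := D.β (Sum.inr lam)
  let β'₀ : galoisCohomology ρF 1 := D.β' (Sum.inr lam)
  -- `φ` represents `β'_λ`, `ψβ` represents `β_λ`, `ψb` represents `loc_λ b₁`
  let φ : contOneCocycles ρF.toTopRep := rep β'₀
  let ψβ : contOneCocycles ρF.toTopRep := rep β₀
  let ψb : contOneCocycles ρF.toTopRep :=
    contOneCocycles.pullback (absGaloisRestrict K (lam.adicCompletion K))
      (X := discreteTopRep (absoluteGaloisGroup K) (geomTorsion (W.baseChange K) ((p ^ M₀ * p ^ M₀ : ℕ) : ℤ)))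
      (Y := ρF.toTopRep)
      (TopRep.ofHom ⟨ContinuousLinearMap.id ℤ _, fun _ => rfl⟩)
      (reprCocycle (W.baseChange K) ((p ^ M₀ * p ^ M₀ : ℕ) : ℤ) D.b₁)
  have hψbcl : galoisCohomology.res ((W.baseChange K).torsionGaloisModule ((p ^ M₀ * p ^ M₀ : ℕ) : ℤ))
      (lam.adicCompletion K) 1 D.b₁ = oneCocycleClass _ ψb := by
    have h := (W.baseChange K).res_torsionGaloisModule_oneCocycleClass ((p ^ M₀ * p ^ M₀ : ℕ) : ℤ)
      (lam.adicCompletion K) (reprCocycle (W.baseChange K) ((p ^ M₀ * p ^ M₀ : ℕ) : ℤ) D.b₁)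
    rw [oneCocycleClass_reprCocycle] at h
    exact h
  -- ### the local term: `inv_λ((loc b₁ - β) ∪ β') = 0`, so `β' ∪ (loc b₁ - β) = 0`
  have hcup0 : weilLocalCup (W.baseChange K) (p ^ M₀) (lam.adicCompletion K) e hμ hadd₁ hadd₂ hgal
      (galoisCohomology.res ((W.baseChange K).torsionGaloisModule ((p ^ M₀ * p ^ M₀ : ℕ) : ℤ))
        (lam.adicCompletion K) 1 D.b₁ - β₀) β'₀ = 0 := by
    have h : inv (Sum.inr lam) (weilLocalCup (W.baseChange K) (p ^ M₀) (lam.adicCompletion K) e hμ hadd₁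
      hadd₂ hgal (galoisCohomology.res ((W.baseChange K).torsionGaloisModule ((p ^ M₀ * p ^ M₀ : ℕ) : ℤ))
        (lam.adicCompletion K) 1 D.b₁ - β₀) β'₀) = 0 := hD0
    exact hinv (h.trans (map_zero _).symm)
  rw [weilLocalCup_comm_of_forall_smul_eq (W.baseChange K) (p ^ M₀) (lam.adicCompletion K) e hμ hadd₁
    hadd₂ hgal halt htriv, weilLocalCup_apply] at hcup0
  have hφcl : β'₀ = oneCocycleClass ρF.toTopRep φ := (hrep _).symm
  have hψcl : galoisCohomology.res ((W.baseChange K).torsionGaloisModule ((p ^ M₀ * p ^ M₀ : ℕ) : ℤ))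
      (lam.adicCompletion K) 1 D.b₁ - β₀ = oneCocycleClass ρF.toTopRep (ψb - ψβ) := by
    rw [oneCocycleClass_sub, hrep, ← hψbcl]
    rfl
  rw [hφcl, hψcl] at hcup0
  -- `φ` vanishes on `I_{K_λ}` (`β'_λ ∈ 𝓛_λ = H¹_ur`), and so does `ψβ`
  have hIm : ∀ τ ∈ absInertia (lam.adicCompletion K),
      ∀ P : geomTorsion (W.baseChange K) (((p ^ M₀ * p ^ M₀ : ℕ)) : ℤ),
      absGaloisRestrict K (lam.adicCompletion K) τ • P = P := fun τ _ P => htriv τ P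
  have hφ : ∀ τ ∈ absInertia (lam.adicCompletion K), φ.1 τ = 0 :=
    apply_eq_zero_of_mem_kummerLocalConditionAt W K (n := p ^ M₀ * p ^ M₀) hn2 hpv hgood hIm φ
      (by rw [hrep]; exact D.β'_mem (Sum.inr lam))
  have hψβ : ∀ τ ∈ absInertia (lam.adicCompletion K), ψβ.1 τ = 0 :=
    apply_eq_zero_of_mem_kummerLocalConditionAt W K (n := p ^ M₀ * p ^ M₀) hn2 hpv hgood hIm ψβ
      (by rw [hrep]; exact D.β_mem (Sum.inr lam))
  -- ### Gross (7.6): `e(φ(gF), (ψb - ψβ)(t')) = 1`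
  have hloc := TameCup.weilPairing_apply_eq_one_of_cupProduct_eq_zero (W.baseChange K) (p ^ M₀ * p ^ M₀)
    e hμ hadd₁ hadd₂ (lam.adicCompletion K) halt hnondeg hgal ε hnc htriv (inv (Sum.inr lam)) hinv
    φ (ψb - ψβ) hφ hcup0 gF t' ht'
  have hsub : (ψb - ψβ).1 t' = ψb.1 t' - ψβ.1 t' := rfl
  rw [hsub, hψβ t' ht', sub_zero, contOneCocycles.pullback_apply, hgt] at hloc
  change e (φ.1 gF) (h1Eval (W.baseChange K) ((p ^ M₀ * p ^ M₀ : ℕ) : ℤ) D.b₁ (g * σ * g⁻¹)) = 1 at hloc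
  -- ### `m • φ(gF) = [t, F₀]`
  -- the class `[m]_* β' = loc b'` on cocycles, at level `m`
  let ρFm : DiscreteGaloisModule (lam.adicCompletion K) (geomTorsion (W.baseChange K) ((p ^ M₀ : ℕ) : ℤ)) :=
    GaloisRep.restrictField (lam.adicCompletion K) ((W.baseChange K).torsionGaloisModule ((p ^ M₀ : ℕ) : ℤ))
  have htrivXm : ∀ (g' : absoluteGaloisGroup (lam.adicCompletion K)) (x : ρFm.toTopRep),
      ρFm.toTopRep.ρ g' x = x := htrivm
  let χ : contOneCocycles ρFm.toTopRep :=
    contOneCocycles.pullback (ContinuousMonoidHom.id (absoluteGaloisGroup (lam.adicCompletion K)))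
      (X := ρF.toTopRep) (Y := ρFm.toTopRep)
      (TopRep.ofHom ⟨((mulK (W.baseChange K) (p ^ M₀) (p ^ M₀)).restrictField
        (lam.adicCompletion K)).toContinuousLinearMap,
        ((mulK (W.baseChange K) (p ^ M₀) (p ^ M₀)).restrictField (lam.adicCompletion K)).isIntertwining'⟩) φ
  let ψb' : contOneCocycles ρFm.toTopRep :=
    contOneCocycles.pullback (absGaloisRestrict K (lam.adicCompletion K))
      (X := discreteTopRep (absoluteGaloisGroup K) (geomTorsion (W.baseChange K) ((p ^ M₀ : ℕ) : ℤ)))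
      (Y := ρFm.toTopRep)
      (TopRep.ofHom ⟨ContinuousLinearMap.id ℤ _, fun _ => rfl⟩)
      (reprCocycle (W.baseChange K) ((p ^ M₀ : ℕ) : ℤ) D.b')
  have hχcl : oneCocycleClass ρFm.toTopRep χ = oneCocycleClass ρFm.toTopRep ψb' := by
    have h1 : oneCocycleClass ρFm.toTopRep χ =
        galoisCohomology.map ((mulK (W.baseChange K) (p ^ M₀) (p ^ M₀)).restrictField
          (lam.adicCompletion K)) 1 β'₀ := by
      rw [hφcl, galoisCohomology.map_one_oneCocycleClass]
    have h2 : galoisCohomology.res ((W.baseChange K).torsionGaloisModule ((p ^ M₀ : ℕ) : ℤ))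
        (lam.adicCompletion K) 1 D.b' = oneCocycleClass _ ψb' := by
      have h := (W.baseChange K).res_torsionGaloisModule_oneCocycleClass ((p ^ M₀ : ℕ) : ℤ)
        (lam.adicCompletion K) (reprCocycle (W.baseChange K) ((p ^ M₀ : ℕ) : ℤ) D.b')
      rw [oneCocycleClass_reprCocycle] at h
      exact h
    have h3 : galoisCohomology.map ((mulK (W.baseChange K) (p ^ M₀) (p ^ M₀)).restrictField
          (lam.adicCompletion K)) 1 β'₀ =
        galoisCohomology.res ((W.baseChange K).torsionGaloisModule ((p ^ M₀ : ℕ) : ℤ))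
          (lam.adicCompletion K) 1 D.b' := D.map_β' (Sum.inr lam)
    exact h1.trans (h3.trans h2)
  have hval1 : mulK (W.baseChange K) (p ^ M₀) (p ^ M₀) (φ.1 gF) =
      h1Eval (W.baseChange K) ((p ^ M₀ : ℕ) : ℤ) D.b' (g * F * g⁻¹) := by
    have h := TameCup.apply_eq_of_oneCocycleClass_eq htrivXm hχcl gF
    rw [contOneCocycles.pullback_apply, contOneCocycles.pullback_apply, hgF] at h
    exact h
  -- `[t, F₀] = ι [b', F₀]`
  have hval2 : h1Eval (W.baseChange K) ((p ^ M₀ * p ^ M₀ : ℕ) : ℤ) t (g * F * g⁻¹) =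
      inclKD (W.baseChange K) (p ^ M₀) (p ^ M₀)
        (h1Eval (W.baseChange K) ((p ^ M₀ : ℕ) : ℤ) D.b' (g * F * g⁻¹)) := by
    let χ2 : contOneCocycles (discreteTopRep (absoluteGaloisGroup K)
        (geomTorsion (W.baseChange K) ((p ^ M₀ * p ^ M₀ : ℕ) : ℤ))) :=
      contOneCocycles.pullback (ContinuousMonoidHom.id (absoluteGaloisGroup K))
        (X := discreteTopRep (absoluteGaloisGroup K) (geomTorsion (W.baseChange K) ((p ^ M₀ : ℕ) : ℤ)))
        (Y := discreteTopRep (absoluteGaloisGroup K) (geomTorsion (W.baseChange K) ((p ^ M₀ * p ^ M₀ : ℕ) : ℤ)))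
        (TopRep.ofHom ⟨(inclKD (W.baseChange K) (p ^ M₀) (p ^ M₀)).toContinuousLinearMap,
          (inclKD (W.baseChange K) (p ^ M₀) (p ^ M₀)).isIntertwining'⟩)
        (reprCocycle (W.baseChange K) ((p ^ M₀ : ℕ) : ℤ) D.b')
    have hmap := galoisCohomology.map_one_oneCocycleClass (inclKD (W.baseChange K) (p ^ M₀) (p ^ M₀))
      (reprCocycle (W.baseChange K) ((p ^ M₀ : ℕ) : ℤ) D.b')
    have hb' : oneCocycleClass _ (reprCocycle (W.baseChange K) ((p ^ M₀ : ℕ) : ℤ) D.b') = D.b' :=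
      oneCocycleClass_reprCocycle _ _ _
    have hcl : oneCocycleClass _ χ2 =
        oneCocycleClass _ (reprCocycle (W.baseChange K) ((p ^ M₀ * p ^ M₀ : ℕ) : ℤ) t) := by
      refine (hmap.symm.trans ?_).trans (oneCocycleClass_reprCocycle (W.baseChange K) _ t).symm
      exact (congrArg (galoisCohomology.map (inclKD (W.baseChange K) (p ^ M₀) (p ^ M₀)) 1) hb').trans ht
    have h := cocycle_apply_eq_of_oneCocycleClass_eq (W.baseChange K) _ hcl hF₀fix
    have h' := contOneCocycles.pullback_apply (ContinuousMonoidHom.id (absoluteGaloisGroup K))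
        (X := discreteTopRep (absoluteGaloisGroup K) (geomTorsion (W.baseChange K) ((p ^ M₀ : ℕ) : ℤ)))
        (Y := discreteTopRep (absoluteGaloisGroup K) (geomTorsion (W.baseChange K) ((p ^ M₀ * p ^ M₀ : ℕ) : ℤ)))
        (TopRep.ofHom ⟨(inclKD (W.baseChange K) (p ^ M₀) (p ^ M₀)).toContinuousLinearMap,
          (inclKD (W.baseChange K) (p ^ M₀) (p ^ M₀)).isIntertwining'⟩)
        (reprCocycle (W.baseChange K) ((p ^ M₀ : ℕ) : ℤ) D.b') (g * F * g⁻¹)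
    exact (h.symm.trans h')
  have hval : (p ^ M₀) • φ.1 gF = h1Eval (W.baseChange K) ((p ^ M₀ * p ^ M₀ : ℕ) : ℤ) t (g * F * g⁻¹) := by
    rw [hval2, ← hval1, inclKD_mulK]
  -- ### transport along `g`
  have hconjF : g⁻¹ * (g * F * g⁻¹) * g⁻¹⁻¹ = F := by group
  have hconjσ : g⁻¹ * (g * σ * g⁻¹) * g⁻¹⁻¹ = σ := by group
  have h1 : h1Eval (W.baseChange K) ((p ^ M₀ * p ^ M₀ : ℕ) : ℤ) t F =
      g⁻¹ • h1Eval (W.baseChange K) ((p ^ M₀ * p ^ M₀ : ℕ) : ℤ) t (g * F * g⁻¹) := by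
    rw [← h1Eval_conj (W.baseChange K) _ t g⁻¹ hF₀fix, hconjF]
  have h2 : h1Eval (W.baseChange K) ((p ^ M₀ * p ^ M₀ : ℕ) : ℤ) D.b₁ σ =
      g⁻¹ • h1Eval (W.baseChange K) ((p ^ M₀ * p ^ M₀ : ℕ) : ℤ) D.b₁ (g * σ * g⁻¹) := by
    rw [← h1Eval_conj (W.baseChange K) _ D.b₁ g⁻¹ hσ₀fix, hconjσ]
  refine ⟨g⁻¹ • φ.1 gF, ?_, ?_⟩
  · rw [smul_comm, hval, h1]
  · rw [h2, ← hgal, hloc, smul_one]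

end Summit.BirchSwinnertonDyer.Rank1Residual.X11b.KolyvaginCT

end
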